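import Summits.BirchSwinnertonDyer.BirchSwinnertonDyer.Theorems.PrintCf2SplitBadTwoFramePinningDeuring
import HarnessLib

set_option linter.dupNamespace false
set_option autoImplicit false

/-!
# Crux `PrintCf2.SplitBadTwoRankOneOfFacts` (stmt-BirchSwinnertonDyer-20368), road α — FRAME PINNING, VI:
# the EXACT TAME SET of every frame — `S = {w ∤ 2 : w ∣ 7d}`, unconditionally

Width seat `bsd-line-cf2-p1-w6` (brick B8 «pinning lemma», 2026-08-28); sequel of files I–V. Helper
`--supports` stmt-BirchSwinnertonDyer-20368; THEOREMS ONLY.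

Every research stub of the skeleton quantifies over the exact tame set `S` of the frame
(`w ∈ S ↔ ψ` ramified at `w ∧ w ∉ {v, v̄}`), which is the modulus entering `IsKatzBranch ι v v̄ S …`. For a
member `W ≅ cm7^{(d)}` (`d` squarefree) and EVERY Hecke character `ψ` of the frame field `K`
pinned to `W` (no infinity type, no Deuring print), this file computes `S` from `d` ALONE:

* `hasAdditiveReductionAt_of_frame_of_dvd` — `W` is ADDITIVE at every odd prime `p ∣ d`, `p ≠ 7` (tree
  `hasAdditiveReductionAt_quadraticTwist_of_dvd` for the good curve `cm7` + isomorphism invariance);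
* `hasGoodReductionAt_of_frame_of_not_dvd` — `W` is GOOD at every prime `p ∤ 14d` (tree
  `hasGoodReductionAt_quadraticTwist`, `Δ_min(cm7) = −7³`);
* `not_isUnramifiedAt_of_frame_of_dvd` — `ψ` is RAMIFIED at every place above an odd prime `p ∣ 7d`
  (file I §2 at the additive primes `p ∣ d`, `p ≠ 7`, since `p ∤ d_K = −7`; file IV at `p = 7`);
* `isUnramifiedAt_of_frame_of_not_dvd` — `ψ` is UNRAMIFIED at every place above a prime `p ∤ 14d`
  (bsd-cm's `DeuringShape.isUnramifiedAt_of_pinned_of_hasGoodReduction`);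
* `eq_or_eq_of_frame_of_two_mem` — a place above `2` is `v` or `v̄`;
* `mem_frameSet_iff` — **`w ∈ S ↔ ℓ_w ≠ 2 ∧ ℓ_w ∣ 7d`**, `ℓ_w` the rational prime under `w`.

HONEST FRAMING: kernel theorems about reduction types and Hecke characters; nothing about BSD; no stub is
closed. beyond-print theorem: no.

References: [SilvermanAEC2009] VII.1 Rem. 1.1, VII.5 Prop. 5.1, App. C §16; [SilvermanATAEC1994] II Thm. 9.2,
10.5; [NeukirchANT1999] VII §8 (8.1).
-/

noncomputable section

open scoped Classical
open Filter NumberField IsDedekindDomain WeierstrassCurve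
  Literature.NumberTheory.GaloisRepresentations
  Literature.NumberTheory.LFunctions
  Literature.NumberTheory.EllipticCurves
  Literature.NumberTheory.EllipticCurves.ModularForms
  Literature.NumberTheory.EllipticCurves.Rank1Residual
  Summit.BirchSwinnertonDyer.Rank1Residual
  Summit.BirchSwinnertonDyer.BirchSwinnertonDyer.Theorems.RamifiedSevenEllipticUnits

namespace Summit.BirchSwinnertonDyer.BirchSwinnertonDyer.Theorems.PrintCf2.FramePinning

variable {K : Type} [Field K] [NumberField K]
variable {d : ℤ} {W : WeierstrassCurve ℚ} [W.IsElliptic] [W.IsGloballyMinimal] {C : VariableChange ℚ}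
  {v vbar : HeightOneSpectrum (𝓞 K)} {ψ : HeckeCharacter K}

/-! ## §1 Reduction types of a member `W ≅ cm7^{(d)}` at the odd primes -/

omit [W.IsGloballyMinimal] in
/-- **`W ≅ cm7^{(d)}` is ADDITIVE at every odd prime `p ∣ d`, `p ≠ 7`** (`d` squarefree): `cm7` is good at
`p`, so its twist by the ramified `d` is additive (`hasAdditiveReductionAt_quadraticTwist_of_dvd`), and
additivity is an isomorphism invariant (`hasAdditiveReductionAt_smul_iff_holds`).
[cite: SilvermanAEC2009, VII.1 Remark 1.1 and VII.5 Prop. 5.1(c)] -/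
theorem hasAdditiveReductionAt_of_frame_of_dvd (hsq : Squarefree d) (hC : C • W = cm7.quadraticTwist (d : ℚ))
    {p : ℕ} [Fact p.Prime] (hp2 : p ≠ 2) (hp7 : p ≠ 7) (hpd : (p : ℤ) ∣ d)
    {u : HeightOneSpectrum (𝓞 ℚ)} (hup : (Rat.HeightOneSpectrum.primesEquiv u : ℕ) = p) :
    W.HasAdditiveReductionAt u := by
  subst hup
  have hu2 : (Rat.HeightOneSpectrum.primesEquiv u : ℕ) ≠ 2 := hp2
  have hu7 : (Rat.HeightOneSpectrum.primesEquiv u : ℕ) ≠ 7 := hp7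
  have hud : ((Rat.HeightOneSpectrum.primesEquiv u : ℕ) : ℤ) ∣ d := hpd
  haveI := cm7_isGloballyMinimal
  have hgood : cm7.HasGoodReductionAt u :=
    (hasGoodReductionAtPrime_primesEquiv_iff_holds cm7 u _ rfl).mp
      (cm7_hasGoodReductionAtPrime (Rat.HeightOneSpectrum.primesEquiv u : ℕ) hu7)
  have h2 : ¬ ((Rat.HeightOneSpectrum.primesEquiv u : ℕ) : ℤ) ^ 2 ∣ d := fun h ↦ by
    have hu := hsq ((Rat.HeightOneSpectrum.primesEquiv u : ℕ) : ℤ) (by rw [← pow_two]; exact h)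
    rw [Int.isUnit_iff] at hu
    have := (Rat.HeightOneSpectrum.primesEquiv u).2.one_lt
    omega
  have hX := cm7.hasAdditiveReductionAt_quadraticTwist_of_dvd u hu2 hsq.ne_zero hud h2 hgood
  rw [← hC] at hX
  exact (hasAdditiveReductionAt_smul_iff_holds u W C).mp hX

omit [W.IsElliptic] [W.IsGloballyMinimal] in
/-- **`W ≅ cm7^{(d)}` is GOOD at every prime `p ∤ 14d`** (`Δ_min(cm7) = −7³`; `hasGoodReductionAt_quadraticTwist`
and isomorphism invariance `hasGoodReductionAt_smul_iff_holds`).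
[cite: SilvermanAEC2009, VII.1 Remark 1.1 and VII.5 Prop. 5.1(a)] -/
theorem hasGoodReductionAt_of_frame_of_not_dvd (hC : C • W = cm7.quadraticTwist (d : ℚ))
    {p : ℕ} [Fact p.Prime] (hpd : ¬ (p : ℤ) ∣ 14 * d)
    {u : HeightOneSpectrum (𝓞 ℚ)} (hup : (Rat.HeightOneSpectrum.primesEquiv u : ℕ) = p) :
    W.HasGoodReductionAt u ∧ W.HasGoodReductionAtPrime p := by
  subst hup
  have hu : ¬ ((Rat.HeightOneSpectrum.primesEquiv u : ℕ) : ℤ) ∣ 14 * d := hpd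
  haveI := cm7_isGloballyMinimal
  have hpZ : Prime ((Rat.HeightOneSpectrum.primesEquiv u : ℕ) : ℤ) :=
    Nat.prime_iff_prime_int.mp (Rat.HeightOneSpectrum.primesEquiv u).2
  have h2d : ¬ ((Rat.HeightOneSpectrum.primesEquiv u : ℕ) : ℤ) ∣ 2 * d := fun h ↦
    hu (by rw [show (14 : ℤ) * d = 7 * (2 * d) by ring]; exact h.mul_left 7)
  have h7 : ¬ ((Rat.HeightOneSpectrum.primesEquiv u : ℕ) : ℤ) ∣ 7 := fun h ↦
    hu (by rw [show (14 : ℤ) * d = 7 * (2 * d) by ring]; exact h.mul_right _)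
  have hΔ : ¬ ((Rat.HeightOneSpectrum.primesEquiv u : ℕ) : ℤ) ∣ minimalDiscriminantInt cm7 := by
    rw [cm7_minimalDiscriminantInt, dvd_neg, show (343 : ℤ) = 7 ^ 3 by norm_num]
    exact fun h ↦ h7 (hpZ.dvd_of_dvd_pow h)
  have hX := cm7.hasGoodReductionAt_quadraticTwist u h2d hΔ
  rw [← hC] at hX
  have hgood : W.HasGoodReductionAt u := (hasGoodReductionAt_smul_iff_holds u W C).mp hX
  exact ⟨hgood, (hasGoodReductionAtPrime_primesEquiv_iff_holds W u _ rfl).mpr hgood⟩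

/-! ## §2 Ramification of the frame character off `2` -/

/-- **`ψ` is RAMIFIED above every odd prime `p ∣ 7d`**, for every Hecke character `ψ` of the frame field
pinned to `W ≅ cm7^{(d)}` (`d ≢ 1 (mod 4)` squarefree; `v ≠ v̄` above `2`): at `p = 7` by file IV
(`not_isUnramifiedAt_seven_of_frame`), at `p ∣ d`, `p ≠ 7` by file I §2 (additive prime, `p ∤ d_K = −7`).
[cite: SilvermanAEC2009, App. C §16] [cite: NeukirchANT1999, Ch. VII §8 (8.1)] -/
theorem not_isUnramifiedAt_of_frame_of_dvd (hsq : Squarefree d)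
    (hC : C • W = cm7.quadraticTwist (d : ℚ))
    (hK : IsImaginaryQuadratic K) (hv : ((2 : ℕ) : 𝓞 K) ∈ v.asIdeal) (hvbar : ((2 : ℕ) : 𝓞 K) ∈ vbar.asIdeal)
    (hne : vbar ≠ v) (hpin : ∀ s : ℂ, 3 / 2 < s.re → heckeLFunction ψ s = W.LSeries s)
    {p : ℕ} [hp : Fact p.Prime] (hp2 : p ≠ 2) (hpd : (p : ℤ) ∣ 7 * d)
    (w : HeightOneSpectrum (𝓞 K)) (hw : ((p : ℕ) : 𝓞 K) ∈ w.asIdeal) : ¬ ψ.IsUnramifiedAt w := by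
  have hd0 : d ≠ 0 := hsq.ne_zero
  by_cases h7 : p = 7
  · subst h7
    exact not_isUnramifiedAt_seven_of_frame hd0 hC hK hv hvbar hne hpin w hw
  · have hpZ : Prime (p : ℤ) := Nat.prime_iff_prime_int.mp hp.out
    have hp7 : ¬ (p : ℤ) ∣ 7 := fun h ↦ h7 ((Nat.prime_dvd_prime_iff_eq hp.out (by decide)).mp
      (Int.natCast_dvd_natCast.mp h))
    have hpd' : (p : ℤ) ∣ d := (hpZ.dvd_or_dvd hpd).resolve_left hp7
    have hD : NumberField.discr K = -7 := discr_eq_neg_seven_of_frame hd0 hC hK hv hvbar hne hpin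
    have hnd : ¬ (p : ℤ) ∣ NumberField.discr K := by rw [hD, dvd_neg]; exact hp7
    set u : HeightOneSpectrum (𝓞 ℚ) := Rat.HeightOneSpectrum.primesEquiv.symm ⟨p, hp.out⟩ with hudef
    have hup : (Rat.HeightOneSpectrum.primesEquiv u : ℕ) = p := by rw [hudef, Equiv.apply_symm_apply]
    have hadd := hasAdditiveReductionAt_of_frame_of_dvd hsq hC hp2 h7 hpd' hup
    exact not_isUnramifiedAt_of_pinned_of_hasAdditiveReductionAt hK.1 W (3 / 2) hpin hnd hup hadd w hw

/-- **`ψ` is UNRAMIFIED above every prime `p ∤ 14d`** (good prime of `W`, `p ≠ 7` unramified in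
`K = ℚ(√−7)`; bsd-cm's `DeuringShape.isUnramifiedAt_of_pinned_of_hasGoodReduction`).
[cite: SilvermanATAEC1994, Ch. II Thm. 9.2 (b) (here derived for every pinned character)] -/
theorem isUnramifiedAt_of_frame_of_not_dvd (hsq : Squarefree d) (hC : C • W = cm7.quadraticTwist (d : ℚ))
    (hK : IsImaginaryQuadratic K) (hv : ((2 : ℕ) : 𝓞 K) ∈ v.asIdeal) (hvbar : ((2 : ℕ) : 𝓞 K) ∈ vbar.asIdeal)
    (hne : vbar ≠ v) (hpin : ∀ s : ℂ, 3 / 2 < s.re → heckeLFunction ψ s = W.LSeries s)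
    {p : ℕ} [hp : Fact p.Prime] (hpd : ¬ (p : ℤ) ∣ 14 * d)
    (w : HeightOneSpectrum (𝓞 K)) (hw : ((p : ℕ) : 𝓞 K) ∈ w.asIdeal) : ψ.IsUnramifiedAt w := by
  have hd0 : d ≠ 0 := hsq.ne_zero
  have hp7 : ¬ (p : ℤ) ∣ 7 := fun h ↦ hpd (by rw [show (14 : ℤ) * d = 7 * (2 * d) by ring]; exact h.mul_right _)
  have hD : NumberField.discr K = -7 := discr_eq_neg_seven_of_frame hd0 hC hK hv hvbar hne hpin
  have hnd : ¬ (p : ℤ) ∣ NumberField.discr K := by rw [hD, dvd_neg]; exact hp7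
  set u : HeightOneSpectrum (𝓞 ℚ) := Rat.HeightOneSpectrum.primesEquiv.symm ⟨p, hp.out⟩ with hudef
  have hup : (Rat.HeightOneSpectrum.primesEquiv u : ℕ) = p := by rw [hudef, Equiv.apply_symm_apply]
  have hgood := (hasGoodReductionAt_of_frame_of_not_dvd hC hpd hup).2
  exact DeuringShape.isUnramifiedAt_of_pinned_of_hasGoodReduction hK.1 hpin hgood hnd w hw

/-! ## §3 The exact tame set -/

/-- **A place above `2` of the frame field is `v` or `v̄`** (`2` splits: two places, `2 ∤ d_K`).
[cite: NeukirchANT1999, Ch. I §8 Prop. (8.2)] -/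
theorem eq_or_eq_of_frame_of_two_mem (h2 : Module.finrank ℚ K = 2)
    (hv : ((2 : ℕ) : 𝓞 K) ∈ v.asIdeal) (hvbar : ((2 : ℕ) : 𝓞 K) ∈ vbar.asIdeal) (hne : vbar ≠ v)
    (w : HeightOneSpectrum (𝓞 K)) (hw : ((2 : ℕ) : 𝓞 K) ∈ w.asIdeal) : w = v ∨ w = vbar := by
  have hnd := not_two_dvd_discr_of_ne h2 hv hvbar hne
  set u : HeightOneSpectrum (𝓞 ℚ) := v.under (𝓞 ℚ) with hu
  have hvu : v.asIdeal.under (𝓞 ℚ) = u.asIdeal := rfl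
  have hgen : Rat.HeightOneSpectrum.natGenerator u = 2 :=
    natGenerator_under_eq_of_natCast_mem v Nat.prime_two hv
  have he : u.asIdeal.ramificationIdxIn (𝓞 K) = 1 :=
    ramificationIdxIn_eq_one_of_not_dvd_discr (K := K) u (by rw [hgen]; exact hnd)
  have hvbaru : vbar.asIdeal.under (𝓞 ℚ) = u.asIdeal :=
    (asIdeal_under_eq_iff_natCast_mem u vbar).mpr (by rw [hgen]; exact hvbar)
  have hwu : w.asIdeal.under (𝓞 ℚ) = u.asIdeal :=
    (asIdeal_under_eq_iff_natCast_mem u w).mpr (by rw [hgen]; exact hw)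
  rcases exists_places_eq_pair_or_eq_singleton h2 u he with
    ⟨w₁, w₂, -, hS, -, -⟩ | ⟨w₀, hS, -⟩
  · have hv' : v ∈ ({w₁, w₂} : Set (HeightOneSpectrum (𝓞 K))) := by rw [← hS]; exact hvu
    have hvbar' : vbar ∈ ({w₁, w₂} : Set (HeightOneSpectrum (𝓞 K))) := by rw [← hS]; exact hvbaru
    have hw' : w ∈ ({w₁, w₂} : Set (HeightOneSpectrum (𝓞 K))) := by rw [← hS]; exact hwu
    simp only [Set.mem_insert_iff, Set.mem_singleton_iff] at hv' hvbar' hw'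
    rcases hw' with rfl | rfl <;> rcases hv' with h₁ | h₁ <;> rcases hvbar' with h₂ | h₂
    all_goals first
      | exact Or.inl h₁.symm
      | exact Or.inr h₂.symm
      | exact absurd (h₂.trans h₁.symm) hne
  · have hv' : v ∈ ({w₀} : Set (HeightOneSpectrum (𝓞 K))) := by rw [← hS]; exact hvu
    have hvbar' : vbar ∈ ({w₀} : Set (HeightOneSpectrum (𝓞 K))) := by rw [← hS]; exact hvbaru
    simp only [Set.mem_singleton_iff] at hv' hvbar'
    exact absurd (hvbar'.trans hv'.symm) hne

/-- **THE EXACT TAME SET OF THE FRAME.** For a member `W ≅ cm7^{(d)}` (`d ≢ 1 (mod 4)` squarefree), a frame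
field `K` (imaginary quadratic, `v ≠ v̄` above `2`), EVERY Hecke character `ψ` of `K` pinned to `W`, and the
set `S` of the stubs (`w ∈ S ↔ ψ` ramified at `w ∧ w ≠ v ∧ w ≠ v̄`): for every place `w`, with `ℓ` the
rational prime under `w`, **`w ∈ S ↔ ℓ ≠ 2 ∧ ℓ ∣ 7d`**. So the modulus of the Katz frame is determined by
`d`: the places above the odd primes dividing `7d` (for `K = ℚ(√−7)`: `𝔭₇` and the one or two places above
each odd `ℓ ∣ d`, `ℓ ≠ 7`). [cite: SilvermanATAEC1994, Ch. II Thm. 9.2 (b) and Thm. 10.5 (ψ ramified exactly at the bad places)]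
[cite: SilvermanAEC2009, VII.5 Prop. 5.1] -/
theorem mem_frameSet_iff (hsq : Squarefree d)
    (hC : C • W = cm7.quadraticTwist (d : ℚ))
    (hK : IsImaginaryQuadratic K) (hv : ((2 : ℕ) : 𝓞 K) ∈ v.asIdeal) (hvbar : ((2 : ℕ) : 𝓞 K) ∈ vbar.asIdeal)
    (hne : vbar ≠ v) (hpin : ∀ s : ℂ, 3 / 2 < s.re → heckeLFunction ψ s = W.LSeries s)
    {S : Finset (HeightOneSpectrum (𝓞 K))}
    (hS : ∀ w : HeightOneSpectrum (𝓞 K), w ∈ S ↔ (¬ ψ.IsUnramifiedAt w ∧ w ≠ v ∧ w ≠ vbar))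
    (w : HeightOneSpectrum (𝓞 K)) :
    w ∈ S ↔ (Rat.HeightOneSpectrum.natGenerator (w.under (𝓞 ℚ)) ≠ 2 ∧
      (Rat.HeightOneSpectrum.natGenerator (w.under (𝓞 ℚ)) : ℤ) ∣ 7 * d) := by
  set ℓ : ℕ := Rat.HeightOneSpectrum.natGenerator (w.under (𝓞 ℚ)) with hℓ
  haveI hℓp : Fact ℓ.Prime := ⟨Rat.HeightOneSpectrum.prime_natGenerator _⟩
  have hℓZ : Prime (ℓ : ℤ) := Nat.prime_iff_prime_int.mp hℓp.out
  have hw : ((ℓ : ℕ) : 𝓞 K) ∈ w.asIdeal := (asIdeal_under_eq_iff_natCast_mem (w.under (𝓞 ℚ)) w).mp rfl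
  rw [hS]
  constructor
  · rintro ⟨hram, hwv, hwvbar⟩
    have hℓ2 : ℓ ≠ 2 := by
      intro h
      rcases eq_or_eq_of_frame_of_two_mem hK.1 hv hvbar hne w (by rw [← h]; exact hw) with h' | h'
      · exact hwv h'
      · exact hwvbar h'
    refine ⟨hℓ2, ?_⟩
    by_contra hnot
    have h14 : ¬ (ℓ : ℤ) ∣ 14 * d := by
      intro h
      rw [show (14 : ℤ) * d = 2 * (7 * d) by ring] at h
      rcases hℓZ.dvd_or_dvd h with h2 | h7d
      · exact hℓ2 ((Nat.prime_dvd_prime_iff_eq hℓp.out Nat.prime_two).mp (Int.natCast_dvd_natCast.mp h2))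
      · exact hnot h7d
    exact hram (isUnramifiedAt_of_frame_of_not_dvd hsq hC hK hv hvbar hne hpin h14 w hw)
  · rintro ⟨hℓ2, hℓd⟩
    have hram := not_isUnramifiedAt_of_frame_of_dvd hsq hC hK hv hvbar hne hpin hℓ2 hℓd w hw
    have h2w : ((2 : ℕ) : 𝓞 K) ∉ w.asIdeal := by
      intro h2
      exact hℓ2 (natGenerator_under_eq_of_natCast_mem w Nat.prime_two h2)
    exact ⟨hram, fun h ↦ h2w (h ▸ hv), fun h ↦ h2w (h ▸ hvbar)⟩

end Summit.BirchSwinnertonDyer.BirchSwinnertonDyer.Theorems.PrintCf2.FramePinning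

end
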